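import Literature.MathematicalPhysics.QuantumFieldTheory.Balaban1983to89.B9Eq373V3
import Literature.MathematicalPhysics.QuantumFieldTheory.Balaban1983to89.B9Eq372Operator

/-!
# `Balaban1983to89.B9Eq373V3Analytic` — B9, p. 407: «The operators V₃(A), P₁(A), P₂(A) depend analytically on A in the
# domain (3.37).» MADE HONEST FOR `V₃`: the map `A ↦ (V₃(A)A′)(b)` (`B9Eq373V3.V₃val`) — and, on the way, every object of
# pp. 404–407 built from `U′U = e^{iηA}U`: the bond and plaquette variables of `U′U` and their inverses, the transports, `D_{U′U}`,
# `D*_{U′U}`, the weights `z_{U′U}(p)`, `y_{U′U}(p)` of (3.10), `Δ′(U′U)A′`, `D*_{U′U}D_{U′U}A′` ((3.71)), `D_{U′U}D*_{U′U}A′` ((3.75)),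
# `V₁(A)A′`, `V₂(A)A′` — is COMPLEX-ANALYTIC in `A`: jointly on the field space of a finite lattice (entire, a fortiori on the
# domain (3.37)), along every complex line `A + tB` on any lattice, and along any analytic parametrisation; v1

CITATION HEADER (lean-in-tree rule).  Audit cell `pub-balaban`, surge node-prover lineage pv27 (B9 pp. 390–392, 396–397, 404–407),
unit `b2b-balaban-pv27-g20` (journal CLAIM l.718 of the post-rotation `CLAIMS.log`, node B9-EQ382-V3-ANALYTIC; second node of the
seat, after B9-EQ373-V3 = `B9Eq373V3` (p193995), which is imported BY NAME together with `B9Eq372Operator` (p192387, unit `…-g19`);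
nothing of either is restated).  Source: T. Bałaban, *Propagators for lattice gauge theories in a background field*, Commun. Math.
Phys. **99** (1985) 389–434 [Balaban1985BackgroundPropagators] (cell paper B9; journal page = PDF page + 388), p. 407 [PDF 19] (the
sentence after (3.83)) with (3.37) p. 396 [PDF 8], quoted from the page renders `b2b-balaban-ref1/pages/1985-cmp99-background-
propagators/…-p019-x4.png` and `…-p008-x2.png` READ AS IMAGES by this seat (2026-08-19).

HONEST FRAMING (cell charter, verbatim in substance).  The cell audits Bałaban's papers; discharging its end statements would make
Bałaban's ultraviolet stability theorem unconditional inside this package — a constructive-QFT statement; it is NOT the continuum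
limit and NOT the Clay problem.  THIS FILE DISCHARGES NOTHING of the series: it certifies ONE qualitative sentence of B9 §3 for ONE of
its three operators (`V₃`; `P₁(A)` and `P₂(A)` belong to other lanes of the cell and are not touched), in the lineage's model, where it
is a composition-of-analytic-maps fact: the only transcendental ingredient of `V₃(A)` is the exponential `U′ = e^{iηA}`, which is an
entire function of the letter in a complete normed algebra (Mathlib's `NormedSpace.exp_analytic`); inverses of units are analytic
(Mathlib's `analyticAt_inverse`); everything else is a polynomial in finitely many letters, transports and plaquette variables.

ABSOLUTE RULE honoured: no programme-internal statement is cited; Mathlib's analytic-function API (`AnalyticAt`, `AnalyticOnNhd`,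
`NormedSpace.exp_analytic`, `analyticAt_inverse`, `ContinuousLinearMap.analyticAt`, `Finset.analyticAt_fun_sum`) and the lineage's
definitions and identities are used BY NAME; every theorem below is kernel-checked.

LETTERS AND NORMALISATION (as in the lineage).  `𝔸` a complete normed ℂ-algebra (the ambient matrix algebra), sites `S`,
directions `ι`, shifts `T ν : S ≃ S`, background `U : ι → S → 𝔸ˣ` (ARBITRARY units — no smallness, no group condition is needed
for analyticity), exponent field `A : ι → S → 𝔸` (the print's `A` of `V₃(A)`, i.e. the `A′ ∈ 𝔤^c` of (3.37): «We have to consider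
operators extended to configurations U with values in the complexified group G^c. […] We assume that they have the form U′U, where
U has values in G and U′ = e^{iηA′}, A′∈𝔤^c», p. 396 — so «analytically» means holomorphy in the complexified letters, which is what
the ℂ-linear carrier types), test field `A′ : ι → S → 𝔸`, bond `b = ⟨x, x+e_μ⟩` = `(μ, x)`.  `U′U = prodCfg U η A`
(`B9Eq39Adjoint.prodCfg`, bond variables `e^{iηA(b′)}U(b′)` by `B9Eq369Product.val_prodCfg`); `(V₃(A)A′)(b) = B9Eq373V3.V₃val T U η A
A′ μ x = η⁻²·V₁op − ((Δ′(U′U)A′)(b) − (Δ′(U)A′)(b)) + η⁻²·V₂op` (printed scale; see `B9Eq373V3`, LETTERS AND NORMALISATION).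
PARAMETRISATIONS: `E` is any complex normed space and `e ↦ A(e)`, `e ↦ A′(e)` are maps `E → (ι → S → 𝔸)` with every LETTER
`e ↦ A(e)(b′)` analytic at `e₀` (`AnalyticAt ℂ`); the two instances used for the headline statements are the identity of the field
space `ι → S → 𝔸` of a FINITE lattice (a complex Banach space for the sup norm (3.39); its letters are continuous linear functionals)
and the complex lines `t ↦ A + tB` (`E = ℂ`, any lattice).

WHAT IS IN PRINT (B9 p. 407 [PDF 19], verbatim, after (3.83)): «with the norm |A′| restricted to the blocks defined above. The
operators V₃(A), P₁(A), P₂(A) depend analytically on A in the domain (3.37). Let us denote the sum of these three operators by V(A).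
We can write (3.82) as Δ_a(U′U) = Δ_a(U) − V(A) = (I − V(A)G(U))Δ_a(U). (3.84)»; p. 396 [PDF 8]: «For a given pair of positive
numbers α₀, α₁ we consider the class of these configurations satisfying: U satisfies the condition (3.35), and
|A′| < α₁(L^jη)⁻¹, |∇^η_U A′| < α₁(L^jη)⁻² on Ω_j, j = 0, …, k; (3.37)».  The definition of `V₃(A)` by (3.82) and the bound (3.73)
it satisfies are quoted and certified in `B9Eq373V3` (imported).

WHAT THIS FILE PROVES (all [folklore]; `e₀ ∈ E` arbitrary, `𝒱 : E → (ι → S → 𝔸ˣ)` an analytic family, `A(e)`, `A′(e)` letterwise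
analytic at `e₀`):
* §1 BUILDING BLOCKS: **`analyticAt_val_inv`** (`e ↦ W(e)⁻¹` analytic when `e ↦ W(e) ∈ 𝔸ˣ` is — `Ring.inverse_unit` +
  `analyticAt_inverse`), `analyticAt_csmul`, **`analyticAt_exp_comp`** (`e ↦ exp X(e)` — `NormedSpace.exp_analytic`).
* §2 ANALYTIC FAMILIES OF CONFIGURATIONS: **`CfgAnalyticAt 𝒱 e₀`** (every bond variable analytic), `CfgAnalyticAt.inv`,
  `cfgAnalyticAt_const` (the background), **`cfgAnalyticAt_prodCfg`** (`e ↦ U′U = e^{iηA(e)}U` is an analytic family).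
* §3 DERIVATIVES: `analyticAt_R`, `analyticAt_R_inv` (transports), **`analyticAt_covD`**, **`analyticAt_covDstar`**, `analyticAt_curl`,
  **`analyticAt_lapDD`** (`D*_𝒱D_𝒱A`), **`analyticAt_gradDiv`** (`D_𝒱D*_𝒱A`) — fields may depend on `e` too.
* §4 `Δ′`: **`analyticAt_plaqU_val`**/**`analyticAt_plaqU_inv_val`** (plaquette variables and reversed contours), `analyticAt_reC`,
  `analyticAt_imC`, **`analyticAt_zP`**, **`analyticAt_yP`** (the weights of (3.10)), `analyticAt_jordanF`, `analyticAt_sgnSum₁…₄`,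
  `analyticAt_commG₁…₄`, **`analyticAt_divP`**, **`analyticAt_divL`** (finite sums; the orientation tests do not depend on `e`),
  **`analyticAt_deltaPrimeOp`** (`e ↦ (Δ′(𝒱(e))A(e))(b)`).
* §5 THE PERTURBATION OPERATORS: **`analyticAt_V₁op`**, **`analyticAt_V₂op`** (through `B9Eq372Operator.V₁op_eq_lapDD_sub` /
  `V₂op_eq_gradDiv_sub`: `V₁(A)A′ = D*_UD_UA′ − D*_{U′U}D_{U′U}A′`, `V₂(A)A′ = D_UD*_UA′ − D_{U′U}D*_{U′U}A′`), and the general statement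
  **`analyticAt_V₃val`**: `e ↦ (V₃(A(e))A′(e))(b)` is analytic at `e₀`.  HEADLINES: **`analyticOnNhd_V₃val_line`** (ANY lattice:
  `t ↦ (V₃(A + tB)A′)(b)` is entire on `ℂ`), `differentiable_V₃val_line`; on a FINITE lattice (`[Fintype ι] [Fintype S]`):
  `analyticAt_apply₂` (letters are continuous linear), `analyticOnNhd_prodCfg_val`, `analyticOnNhd_plaqU_prodCfg_val`,
  `analyticOnNhd_lapDD_prodCfg`, `analyticOnNhd_gradDiv_prodCfg`, `analyticOnNhd_V₁op`, `analyticOnNhd_V₂op`,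
  `analyticOnNhd_deltaPrimeOp_prodCfg` (each ENTIRE in `A`), **`analyticOnNhd_V₃val`** (`A ↦ (V₃(A)A′)(b)` entire),
  **`analyticOnNhd_V₃val_joint`** (jointly analytic in `(A, A′)`), `differentiable_V₃val`, `continuous_V₃val`; THE DOMAIN (3.37):
  **`dom337 T U η α₁ L j`** `= {A | ‖A(b′)‖ < α₁(L^jη)⁻¹ ∀ b′ ∧ ‖(D¹_{U,κ}A_τ)(z)‖ < η·α₁(L^jη)⁻² ∀ κ τ z}`, `isOpen_dom337`,
  `zero_mem_dom337`, and THE PRINTED SENTENCE **`analyticOnNhd_V₃val_dom337`**: `A ↦ (V₃(A)A′)(b)` is analytic on the domain (3.37).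
* §6 SANITY (`example`s): one letter `a ↦ e^{iηa}u`; differentiability of `t ↦ (V₃(tB)A′)(b)` at `0`; `0 ∈ dom337` and analyticity
  there; the constant family.

A REMARK, NOT A DIVERGENCE.  In the typed model every one of these maps is ENTIRE in `A` (no condition on `A`, `U`, `η`): `exp` is
entire and the inverses that occur are inverses of units given in closed form (`(U′U)(b′)⁻¹ = U(b′)⁻¹e^{−iηA(b′)}`).  The print states
analyticity «in the domain (3.37)» because that is where `V₃(A)` is USED (the bounds (3.73), (3.85) need (3.37)) and because the
sentence covers `P₁(A)` as well, whose definition (3.76) involves inverse operators; for `V₃` the printed statement is the restriction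
`analyticOnNhd_V₃val_dom337` of the entire one — STRONGER certified, nothing weaker.  The lattice of the print (`T_η`, a finite torus)
is finite, so `[Fintype S]` in the joint statements is faithful; the line statements need no finiteness.

RELATED IN THE TREE, NOT DUPLICATED (searched 2026-08-19: MODULE-MAP rows B9/B12/Beta; `grep -rn "AnalyticAt\|AnalyticOnNhd\|exp_analytic"
Balaban1983to89/`): the directory's analyticity leaves concern OTHER papers and objects — `B5Strip145Analytic` (B5 (1.45)),
`B7TransferAnalyticMean` (B7), `B12LinearizAnalytic267` (B12 (2.67)), `BlockAveragingFederbushAnalytic`/`BlockAveragingEMLAnalyticMean`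
(block averaging means, implicit-function analyticity), `T4CouplingAnalyticity`/`…Witness`, `T4ShellMeasureAnalytic` (T4 lanes); none
concerns B9 §3, `prodCfg`, `deltaPrimeOp`, `V₁`/`V₂`/`V₃`.  `B9Eq372Operator` proves CONTINUITY and linearity in `A′` of `V₁`, `V₂`
(fixed `A`) — not dependence on `A`.  `B9Eq373V3` lists «analyticity in A» under NOT PROVED; this file discharges that item for `V₃`.

NOT PROVED HERE, NOT CLAIMED: analyticity of `P₁(A)` ((3.76)/(3.77)) and of `P₂(A)` ((3.83)) — other lanes; analyticity of `V₃(A)` as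
an OPERATOR-valued map in operator norm (on a finite lattice it is equivalent to the entrywise statement `analyticOnNhd_V₃val_joint`
by finite-dimensionality in the lattice indices, but the operator packaging of `V₃` is not in the tree — `B9Eq372Operator` packages
`V₁`, `V₂` only); the domain geometry `Ω_j`, `j(b)` (the uniform `dom337` has one scale); that the print's `A` is 𝔤-valued/Hermitian
(irrelevant for analyticity); any bound — (3.73) for `V₃` is `B9Eq373V3.eq373_V₃`.  Records: GAPS C-pv27-81 (no new divergence; the
remark above is informational).  NOT summit progress.
-/

noncomputable section

namespace Literature.MathematicalPhysics.QuantumFieldTheory.Balaban1983to89.B9Eq373V3Analytic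

open NormedSpace Complex
open Literature.MathematicalPhysics.QuantumFieldTheory.Balaban1983to89
open Literature.MathematicalPhysics.QuantumFieldTheory.Balaban1983to89.B9Eq37Insertion (reC imC)
open Literature.MathematicalPhysics.QuantumFieldTheory.Balaban1983to89.B9Eq39Adjoint
open Literature.MathematicalPhysics.QuantumFieldTheory.Balaban1983to89.B9Eq310Hermitian
open Literature.MathematicalPhysics.QuantumFieldTheory.Balaban1983to89.B9Eq369Product
open Literature.MathematicalPhysics.QuantumFieldTheory.Balaban1983to89.B9Eq371Composition
open Literature.MathematicalPhysics.QuantumFieldTheory.Balaban1983to89.B9Eq375Composition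
open Literature.MathematicalPhysics.QuantumFieldTheory.Balaban1983to89.B9Eq372Operator
open Literature.MathematicalPhysics.QuantumFieldTheory.Balaban1983to89.B9Eq386Neumann
open Literature.MathematicalPhysics.QuantumFieldTheory.Balaban1983to89.B9Eq373V3

/-! ## §1 Three analytic building blocks: inverses of units, complex scalars, the exponential -/

section Blocks

variable {𝔸 : Type*} [NormedRing 𝔸] [NormedAlgebra ℂ 𝔸] [CompleteSpace 𝔸]
variable {E : Type*} [NormedAddCommGroup E] [NormedSpace ℂ E]

/-- **INVERSES.**  If a unit-valued map `W` has analytic values `e ↦ W(e) ∈ 𝔸`, then `e ↦ W(e)⁻¹` is analytic too — because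
on units `W⁻¹ = Ring.inverse W` (`Ring.inverse_unit`) and `Ring.inverse` is analytic at every unit of a complete normed algebra
(Mathlib's `analyticAt_inverse`, the Neumann series).  This is what makes the reversed bonds `(U′U)(b′)⁻¹ = U(b′)⁻¹e^{−iηA(b′)}`,
the transports `R(·)⁻¹` and the reversed plaquette contours analytic in `A` without any smallness. [folklore] -/
theorem analyticAt_val_inv {W : E → 𝔸ˣ} {e₀ : E} (h : AnalyticAt ℂ (fun e => (W e : 𝔸)) e₀) :
    AnalyticAt ℂ (fun e => (((W e)⁻¹ : 𝔸ˣ) : 𝔸)) e₀ := by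
  have h1 : AnalyticAt ℂ (fun e => Ring.inverse (W e : 𝔸)) e₀ :=
    (analyticAt_inverse (𝕜 := ℂ) (W e₀)).fun_comp_of_eq h rfl
  exact h1.congr (Filter.Eventually.of_forall fun e => Ring.inverse_unit (W e))

omit [CompleteSpace 𝔸] in
/-- Complex scalar multiples of analytic maps are analytic (the weights `η⁻²`, `½`, `(2i)⁻¹`, `i/2`, `iη` of (3.10) and of
`U′ = e^{iηA}`). [folklore] -/
theorem analyticAt_csmul {X : E → 𝔸} {e₀ : E} (c : ℂ) (h : AnalyticAt ℂ X e₀) :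
    AnalyticAt ℂ (fun e => c • X e) e₀ :=
  (analyticAt_const (v := c)).fun_smul h

/-- **THE EXPONENTIAL.**  `e ↦ exp(X(e))` is analytic when `X` is: Mathlib's `NormedSpace.exp_analytic` (the exponential series has
infinite radius of convergence in a complete normed algebra over `ℂ`) composed with `X`.  This is the analyticity of the fluctuation
variables `U′(b′) = e^{iηA(b′)}` in the letter `A(b′)`. [folklore] [cite: Balaban1985BackgroundPropagators, p.396 before (3.37)] -/
theorem analyticAt_exp_comp {X : E → 𝔸} {e₀ : E} (h : AnalyticAt ℂ X e₀) :
    AnalyticAt ℂ (fun e => exp (X e)) e₀ :=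
  (NormedSpace.exp_analytic (𝕂 := ℂ) (X e₀)).fun_comp_of_eq h rfl

end Blocks

/-! ## §2 Analytic families of configurations; the product configuration `U′U = e^{iηA}U` -/

section Param

variable {𝔸 : Type*} [NormedRing 𝔸] [NormedAlgebra ℂ 𝔸] [CompleteSpace 𝔸] {S : Type*} {ι : Type*}
variable {E : Type*} [NormedAddCommGroup E] [NormedSpace ℂ E]
variable {T : ι → Equiv.Perm S}

omit [CompleteSpace 𝔸] in
/-- AN ANALYTIC FAMILY OF CONFIGURATIONS, parametrised by a complex normed space `E`: `e ↦ 𝒱(e)` with every bond variable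
`e ↦ 𝒱(e)(b′) ∈ 𝔸` analytic at `e₀` (the inverses then come for free, `CfgAnalyticAt.inv`).  The two families of this file: the
constant family `e ↦ U` (the background) and `A ↦ U′U = e^{iηA}U` (`cfgAnalyticAt_prodCfg`), along any analytic parametrisation
`e ↦ A(e)` of the exponent field — the identity of the field space of a finite lattice, or a complex line `t ↦ A + tB`. [folklore]
[cite: Balaban1985BackgroundPropagators, p.396 before (3.37); p.407 after (3.83)] -/
def CfgAnalyticAt (𝒱 : E → ι → S → 𝔸ˣ) (e₀ : E) : Prop :=
  ∀ κ z, AnalyticAt ℂ (fun e => (𝒱 e κ z : 𝔸)) e₀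

/-- The reversed bond variables of an analytic family are analytic. [folklore] -/
theorem CfgAnalyticAt.inv {𝒱 : E → ι → S → 𝔸ˣ} {e₀ : E} (h : CfgAnalyticAt 𝒱 e₀) (κ : ι) (z : S) :
    AnalyticAt ℂ (fun e => (((𝒱 e κ z)⁻¹ : 𝔸ˣ) : 𝔸)) e₀ :=
  analyticAt_val_inv (h κ z)

omit [CompleteSpace 𝔸] in
/-- The constant family (the background `U`, independent of `A`) is analytic. [folklore] -/
theorem cfgAnalyticAt_const (U : ι → S → 𝔸ˣ) (e₀ : E) : CfgAnalyticAt (fun _ : E => U) e₀ :=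
  fun _ _ => analyticAt_const

/-- **`U′U` IS ANALYTIC IN `A`.**  For an analytic parametrisation `e ↦ A(e)` of the exponent field (every letter `e ↦ A(e)(b′)`
analytic at `e₀`), the product configuration `e ↦ U′U = e^{iηA(e)}U` (`B9Eq39Adjoint.prodCfg`; bond variables
`(U′U)(b′) = e^{iηA(b′)}U(b′)`, `B9Eq369Product.val_prodCfg`) is an analytic family. [folklore]
[cite: Balaban1985BackgroundPropagators, p.396 before (3.37); p.407 after (3.83)] -/
theorem cfgAnalyticAt_prodCfg (U : ι → S → 𝔸ˣ) (η : ℝ) {𝒜 : E → ι → S → 𝔸} {e₀ : E}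
    (h𝒜 : ∀ κ z, AnalyticAt ℂ (fun e => 𝒜 e κ z) e₀) :
    CfgAnalyticAt (fun e => prodCfg U η (𝒜 e)) e₀ := by
  intro κ z
  simp only [val_prodCfg]
  exact (analyticAt_exp_comp (analyticAt_csmul _ (h𝒜 κ z))).mul analyticAt_const

/-! ## §3 Transports, covariant derivatives, `D*D` and `DD*` along an analytic family -/

/-- The transport `e ↦ R(𝒱(e)(b′))X(e) = 𝒱(b′)X𝒱(b′)⁻¹` of an analytic `X` is analytic. [folklore]
[cite: Balaban1985BackgroundPropagators, (3.4) p.391] -/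
theorem analyticAt_R {𝒱 : E → ι → S → 𝔸ˣ} {e₀ : E} (h : CfgAnalyticAt 𝒱 e₀) {X : E → 𝔸}
    (hX : AnalyticAt ℂ X e₀) (κ : ι) (z : S) :
    AnalyticAt ℂ (fun e => R (𝒱 e κ z) (X e)) e₀ := by
  simp only [R]
  exact ((h κ z).mul hX).mul (h.inv κ z)

/-- … and so is the reversed transport `e ↦ R(𝒱(e)(b′))⁻¹X(e)`. [folklore] [cite: Balaban1985BackgroundPropagators, (3.5) p.391] -/
theorem analyticAt_R_inv {𝒱 : E → ι → S → 𝔸ˣ} {e₀ : E} (h : CfgAnalyticAt 𝒱 e₀) {X : E → 𝔸}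
    (hX : AnalyticAt ℂ X e₀) (κ : ι) (z : S) :
    AnalyticAt ℂ (fun e => R (𝒱 e κ z)⁻¹ (X e)) e₀ := by
  simp only [R, inv_inv]
  exact ((h.inv κ z).mul hX).mul (h κ z)

/-- The covariant derivative `e ↦ (D¹_{𝒱(e),κ}F(e))(z)` of a pointwise-analytic scalar field `F` along an analytic family.
[folklore] [cite: Balaban1985BackgroundPropagators, (3.4) p.391] -/
theorem analyticAt_covD {𝒱 : E → ι → S → 𝔸ˣ} {e₀ : E} (h : CfgAnalyticAt 𝒱 e₀) {F : E → S → 𝔸}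
    (hF : ∀ s, AnalyticAt ℂ (fun e => F e s) e₀) (κ : ι) (z : S) :
    AnalyticAt ℂ (fun e => covD T (𝒱 e) κ (F e) z) e₀ := by
  simp only [covD]
  exact (analyticAt_R h (hF _) κ z).sub (hF z)

/-- The adjoint covariant derivative `e ↦ (D¹*_{𝒱(e),κ}F(e))(z)`. [folklore] [cite: Balaban1985BackgroundPropagators, (3.5) p.391] -/
theorem analyticAt_covDstar {𝒱 : E → ι → S → 𝔸ˣ} {e₀ : E} (h : CfgAnalyticAt 𝒱 e₀) {F : E → S → 𝔸}
    (hF : ∀ s, AnalyticAt ℂ (fun e => F e s) e₀) (κ : ι) (z : S) :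
    AnalyticAt ℂ (fun e => covDstar T (𝒱 e) κ (F e) z) e₀ := by
  simp only [covDstar]
  exact (analyticAt_R_inv h (hF _) κ _).sub (hF z)

/-- The covariant curl `e ↦ (D_{𝒱(e)}A(e))(p_{μν}(x))` of a letterwise-analytic vector field. [folklore]
[cite: Balaban1985BackgroundPropagators, (3.4) p.391] -/
theorem analyticAt_curl {𝒱 : E → ι → S → 𝔸ˣ} {e₀ : E} (h : CfgAnalyticAt 𝒱 e₀) {𝒜 : E → ι → S → 𝔸}
    (h𝒜 : ∀ κ z, AnalyticAt ℂ (fun e => 𝒜 e κ z) e₀) (μ ν : ι) (x : S) :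
    AnalyticAt ℂ (fun e => curl T (𝒱 e) (𝒜 e) μ ν x) e₀ := by
  simp only [curl]
  exact (analyticAt_covD h (h𝒜 ν) μ x).sub (analyticAt_covD h (h𝒜 μ) ν x)

variable [Fintype ι]

/-- `e ↦ (D*_{𝒱(e)}D_{𝒱(e)}A(e))_μ(x)` (`B9Eq371Composition.lapDD`, the operator expanded in (3.71)) is analytic. [folklore]
[cite: Balaban1985BackgroundPropagators, (3.71) p.405] -/
theorem analyticAt_lapDD {𝒱 : E → ι → S → 𝔸ˣ} {e₀ : E} (h : CfgAnalyticAt 𝒱 e₀) {𝒜 : E → ι → S → 𝔸}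
    (h𝒜 : ∀ κ z, AnalyticAt ℂ (fun e => 𝒜 e κ z) e₀) (μ : ι) (x : S) :
    AnalyticAt ℂ (fun e => lapDD T (𝒱 e) (𝒜 e) μ x) e₀ := by
  simp only [lapDD]
  exact Finset.analyticAt_fun_sum Finset.univ fun ν _ =>
    analyticAt_covDstar h (fun s => analyticAt_curl h h𝒜 ν μ s) ν x

/-- `e ↦ (D_{𝒱(e)}D*_{𝒱(e)}A(e))_μ(x)` (`B9Eq375Composition.gradDiv`, the operator expanded in (3.75)) is analytic. [folklore]
[cite: Balaban1985BackgroundPropagators, (3.75) p.405] -/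
theorem analyticAt_gradDiv {𝒱 : E → ι → S → 𝔸ˣ} {e₀ : E} (h : CfgAnalyticAt 𝒱 e₀) {𝒜 : E → ι → S → 𝔸}
    (h𝒜 : ∀ κ z, AnalyticAt ℂ (fun e => 𝒜 e κ z) e₀) (μ : ι) (x : S) :
    AnalyticAt ℂ (fun e => gradDiv T (𝒱 e) (𝒜 e) μ x) e₀ := by
  simp only [gradDiv]
  exact Finset.analyticAt_fun_sum Finset.univ fun ν _ =>
    analyticAt_covD h (fun s => analyticAt_covDstar h (h𝒜 ν) ν s) μ x

end Param

/-! ## §4 Plaquette variables, the weights of (3.10) and `Δ′` along an analytic family -/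

section DeltaPrime

variable {𝔸 : Type*} [NormedRing 𝔸] [NormedAlgebra ℂ 𝔸] [CompleteSpace 𝔸] {S : Type*} {ι : Type*}
variable {E : Type*} [NormedAddCommGroup E] [NormedSpace ℂ E]
variable {T : ι → Equiv.Perm S}

/-- The plaquette variables `e ↦ 𝒱(e)(∂p)` of an analytic family are analytic (a product of four bond variables). [folklore]
[cite: Balaban1985BackgroundPropagators, (3.1) p.390] -/
theorem analyticAt_plaqU_val {𝒱 : E → ι → S → 𝔸ˣ} {e₀ : E} (h : CfgAnalyticAt 𝒱 e₀) (κ ν : ι) (y : S) :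
    AnalyticAt ℂ (fun e => (plaqU T (𝒱 e) κ ν y : 𝔸)) e₀ := by
  simp only [plaqU, Units.val_mul]
  exact (((h κ y).mul (h ν _)).mul (h.inv κ _)).mul (h.inv ν y)

/-- … and so are the reversed contours `e ↦ 𝒱(e)(∂p)⁻¹` (§1). [folklore] [cite: Balaban1985BackgroundPropagators, (3.1) p.390] -/
theorem analyticAt_plaqU_inv_val {𝒱 : E → ι → S → 𝔸ˣ} {e₀ : E} (h : CfgAnalyticAt 𝒱 e₀) (κ ν : ι) (y : S) :
    AnalyticAt ℂ (fun e => (((plaqU T (𝒱 e) κ ν y)⁻¹ : 𝔸ˣ) : 𝔸)) e₀ :=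
  analyticAt_val_inv (analyticAt_plaqU_val h κ ν y)

/-- The complexified real part `Re W = ½(W + W⁻¹)` (`B9Eq37Insertion.reC`) of an analytic unit-valued map. [folklore]
[cite: Balaban1985BackgroundPropagators, p.391] -/
theorem analyticAt_reC {W : E → 𝔸ˣ} {e₀ : E} (h : AnalyticAt ℂ (fun e => (W e : 𝔸)) e₀) :
    AnalyticAt ℂ (fun e => reC (W e)) e₀ := by
  simp only [reC]
  exact analyticAt_csmul _ (h.add (analyticAt_val_inv h))

/-- The complexified imaginary part `Im W = (2i)⁻¹(W − W⁻¹)` (`B9Eq37Insertion.imC`). [folklore]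
[cite: Balaban1985BackgroundPropagators, p.391] -/
theorem analyticAt_imC {W : E → 𝔸ˣ} {e₀ : E} (h : AnalyticAt ℂ (fun e => (W e : 𝔸)) e₀) :
    AnalyticAt ℂ (fun e => imC (W e)) e₀ := by
  simp only [imC]
  exact analyticAt_csmul _ (h.sub (analyticAt_val_inv h))

/-- The weight `e ↦ z_{𝒱(e)}(p) = η⁻²(Re 𝒱(e)(∂p) − 1)` of (3.10). [folklore] [cite: Balaban1985BackgroundPropagators, (3.10) p.392] -/
theorem analyticAt_zP {𝒱 : E → ι → S → 𝔸ˣ} {e₀ : E} (h : CfgAnalyticAt 𝒱 e₀) (η : ℝ) (κ ν : ι) (y : S) :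
    AnalyticAt ℂ (fun e => zP T (𝒱 e) η κ ν y) e₀ := by
  simp only [zP]
  exact analyticAt_csmul _ ((analyticAt_reC (analyticAt_plaqU_val h κ ν y)).sub analyticAt_const)

/-- The weight `e ↦ y_{𝒱(e)}(p) = η⁻² Im 𝒱(e)(∂p)` of (3.10). [folklore] [cite: Balaban1985BackgroundPropagators, (3.10) p.392] -/
theorem analyticAt_yP {𝒱 : E → ι → S → 𝔸ˣ} {e₀ : E} (h : CfgAnalyticAt 𝒱 e₀) (η : ℝ) (κ ν : ι) (y : S) :
    AnalyticAt ℂ (fun e => yP T (𝒱 e) η κ ν y) e₀ := by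
  simp only [yP]
  exact analyticAt_csmul _ (analyticAt_imC (analyticAt_plaqU_val h κ ν y))

/-- The Jordan-symmetrised first letter function `F^J` of `Δ′` along an analytic family and field. [folklore]
[cite: Balaban1985BackgroundPropagators, (3.10) p.392] -/
theorem analyticAt_jordanF {𝒱 : E → ι → S → 𝔸ˣ} {e₀ : E} (h : CfgAnalyticAt 𝒱 e₀) (η : ℝ)
    {𝒜 : E → ι → S → 𝔸} (h𝒜 : ∀ κ z, AnalyticAt ℂ (fun e => 𝒜 e κ z) e₀) (κ ν : ι) (y : S) :
    AnalyticAt ℂ (fun e => jordanF T (𝒱 e) η (𝒜 e) κ ν y) e₀ := by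
  simp only [jordanF]
  exact analyticAt_csmul _ (((analyticAt_curl h h𝒜 κ ν y).mul (analyticAt_zP h η κ ν y)).add
    ((analyticAt_zP h η κ ν y).mul (analyticAt_curl h h𝒜 κ ν y)))

/-- Signed partner sum `S₁`. [folklore] [cite: Balaban1985BackgroundPropagators, (3.10) p.392] -/
theorem analyticAt_sgnSum₁ {𝒱 : E → ι → S → 𝔸ˣ} {e₀ : E} (h : CfgAnalyticAt 𝒱 e₀)
    {𝒜 : E → ι → S → 𝔸} (h𝒜 : ∀ κ z, AnalyticAt ℂ (fun e => 𝒜 e κ z) e₀) (κ ν : ι) (y : S) :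
    AnalyticAt ℂ (fun e => sgnSum₁ T (𝒱 e) (𝒜 e) κ ν y) e₀ := by
  simp only [sgnSum₁]
  exact (((h𝒜 ν y).neg.add (h𝒜 κ y)).add (analyticAt_R h (h𝒜 ν _) κ y)).neg

/-- Signed partner sum `S₂`. [folklore] [cite: Balaban1985BackgroundPropagators, (3.10) p.392] -/
theorem analyticAt_sgnSum₂ {𝒱 : E → ι → S → 𝔸ˣ} {e₀ : E} (h : CfgAnalyticAt 𝒱 e₀)
    {𝒜 : E → ι → S → 𝔸} (h𝒜 : ∀ κ z, AnalyticAt ℂ (fun e => 𝒜 e κ z) e₀) (κ ν : ι) (y : S) :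
    AnalyticAt ℂ (fun e => sgnSum₂ T (𝒱 e) (𝒜 e) κ ν y) e₀ := by
  simp only [sgnSum₂]
  exact (analyticAt_R h (h𝒜 κ _) ν y).neg.sub ((h𝒜 κ y).add (analyticAt_R h (h𝒜 ν _) κ y))

/-- Signed partner sum `S₃`. [folklore] [cite: Balaban1985BackgroundPropagators, (3.10) p.392] -/
theorem analyticAt_sgnSum₃ {𝒱 : E → ι → S → 𝔸ˣ} {e₀ : E} (h : CfgAnalyticAt 𝒱 e₀)
    {𝒜 : E → ι → S → 𝔸} (h𝒜 : ∀ κ z, AnalyticAt ℂ (fun e => 𝒜 e κ z) e₀) (κ ν : ι) (y : S) :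
    AnalyticAt ℂ (fun e => sgnSum₃ T (𝒱 e) (𝒜 e) κ ν y) e₀ := by
  simp only [sgnSum₃]
  exact ((analyticAt_R h (h𝒜 κ _) ν y).neg.add (h𝒜 ν y).neg).sub (analyticAt_R h (h𝒜 ν _) κ y)

/-- Signed partner sum `S₄`. [folklore] [cite: Balaban1985BackgroundPropagators, (3.10) p.392] -/
theorem analyticAt_sgnSum₄ {𝒱 : E → ι → S → 𝔸ˣ} {e₀ : E} (h : CfgAnalyticAt 𝒱 e₀)
    {𝒜 : E → ι → S → 𝔸} (h𝒜 : ∀ κ z, AnalyticAt ℂ (fun e => 𝒜 e κ z) e₀) (κ ν : ι) (y : S) :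
    AnalyticAt ℂ (fun e => sgnSum₄ T (𝒱 e) (𝒜 e) κ ν y) e₀ := by
  simp only [sgnSum₄]
  exact ((analyticAt_R h (h𝒜 κ _) ν y).neg.add (h𝒜 ν y).neg).add (h𝒜 κ y)

/-- Commutator letter function `G₁ = (i/2)[y, S₁]`. [folklore] [cite: Balaban1985BackgroundPropagators, (3.10) p.392] -/
theorem analyticAt_commG₁ {𝒱 : E → ι → S → 𝔸ˣ} {e₀ : E} (h : CfgAnalyticAt 𝒱 e₀) (η : ℝ)
    {𝒜 : E → ι → S → 𝔸} (h𝒜 : ∀ κ z, AnalyticAt ℂ (fun e => 𝒜 e κ z) e₀) (κ ν : ι) (y : S) :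
    AnalyticAt ℂ (fun e => commG₁ T (𝒱 e) η (𝒜 e) κ ν y) e₀ := by
  simp only [commG₁]
  exact analyticAt_csmul _ (((analyticAt_yP h η κ ν y).mul (analyticAt_sgnSum₁ h h𝒜 κ ν y)).sub
    ((analyticAt_sgnSum₁ h h𝒜 κ ν y).mul (analyticAt_yP h η κ ν y)))

/-- Commutator letter function `G₂ = (i/2)[y, S₂]`. [folklore] [cite: Balaban1985BackgroundPropagators, (3.10) p.392] -/
theorem analyticAt_commG₂ {𝒱 : E → ι → S → 𝔸ˣ} {e₀ : E} (h : CfgAnalyticAt 𝒱 e₀) (η : ℝ)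
    {𝒜 : E → ι → S → 𝔸} (h𝒜 : ∀ κ z, AnalyticAt ℂ (fun e => 𝒜 e κ z) e₀) (κ ν : ι) (y : S) :
    AnalyticAt ℂ (fun e => commG₂ T (𝒱 e) η (𝒜 e) κ ν y) e₀ := by
  simp only [commG₂]
  exact analyticAt_csmul _ (((analyticAt_yP h η κ ν y).mul (analyticAt_sgnSum₂ h h𝒜 κ ν y)).sub
    ((analyticAt_sgnSum₂ h h𝒜 κ ν y).mul (analyticAt_yP h η κ ν y)))

/-- Commutator letter function `G₃ = (i/2)[y, S₃]`. [folklore] [cite: Balaban1985BackgroundPropagators, (3.10) p.392] -/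
theorem analyticAt_commG₃ {𝒱 : E → ι → S → 𝔸ˣ} {e₀ : E} (h : CfgAnalyticAt 𝒱 e₀) (η : ℝ)
    {𝒜 : E → ι → S → 𝔸} (h𝒜 : ∀ κ z, AnalyticAt ℂ (fun e => 𝒜 e κ z) e₀) (κ ν : ι) (y : S) :
    AnalyticAt ℂ (fun e => commG₃ T (𝒱 e) η (𝒜 e) κ ν y) e₀ := by
  simp only [commG₃]
  exact analyticAt_csmul _ (((analyticAt_yP h η κ ν y).mul (analyticAt_sgnSum₃ h h𝒜 κ ν y)).sub
    ((analyticAt_sgnSum₃ h h𝒜 κ ν y).mul (analyticAt_yP h η κ ν y)))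

/-- Commutator letter function `G₄ = (i/2)[y, S₄]`. [folklore] [cite: Balaban1985BackgroundPropagators, (3.10) p.392] -/
theorem analyticAt_commG₄ {𝒱 : E → ι → S → 𝔸ˣ} {e₀ : E} (h : CfgAnalyticAt 𝒱 e₀) (η : ℝ)
    {𝒜 : E → ι → S → 𝔸} (h𝒜 : ∀ κ z, AnalyticAt ℂ (fun e => 𝒜 e κ z) e₀) (κ ν : ι) (y : S) :
    AnalyticAt ℂ (fun e => commG₄ T (𝒱 e) η (𝒜 e) κ ν y) e₀ := by
  simp only [commG₄]
  exact analyticAt_csmul _ (((analyticAt_yP h η κ ν y).mul (analyticAt_sgnSum₄ h h𝒜 κ ν y)).sub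
    ((analyticAt_sgnSum₄ h h𝒜 κ ν y).mul (analyticAt_yP h η κ ν y)))

variable [Fintype ι] [LinearOrder ι]

/-- The plaquette adjoint `e ↦ (D*_{𝒱(e)}F(e))_μ(x)` of (3.9) of a plaquettewise-analytic plaquette function (a finite sum; the
orientation test `ν < μ` does not depend on `e`). [folklore] [cite: Balaban1985BackgroundPropagators, (3.9) p.392] -/
theorem analyticAt_divP {𝒱 : E → ι → S → 𝔸ˣ} {e₀ : E} (h : CfgAnalyticAt 𝒱 e₀)
    {F : E → ι → ι → S → 𝔸} (hF : ∀ κ ν y, AnalyticAt ℂ (fun e => F e κ ν y) e₀) (μ : ι) (x : S) :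
    AnalyticAt ℂ (fun e => divP T (𝒱 e) (F e) μ x) e₀ := by
  simp only [divP]
  refine AnalyticAt.sub ?_ ?_
  · refine Finset.analyticAt_fun_sum _ fun ν _ => ?_
    by_cases hν : ν < μ
    · simp only [hν, if_true]
      exact analyticAt_covDstar h (F := fun e => F e ν μ) (hF ν μ) ν x
    · simp only [hν, if_false]
      exact analyticAt_const
  · refine Finset.analyticAt_fun_sum _ fun ν _ => ?_
    by_cases hν : μ < ν
    · simp only [hν, if_true]
      exact analyticAt_covDstar h (F := fun e => F e μ ν) (hF μ ν) ν x
    · simp only [hν, if_false]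
      exact analyticAt_const

/-- The letter divergence `e ↦ (÷(G₁,G₂,G₃,G₄)(e))_μ(x)` of four plaquettewise-analytic letter functions. [folklore]
[cite: Balaban1985BackgroundPropagators, (3.9) p.392, (3.10) p.392] -/
theorem analyticAt_divL {𝒱 : E → ι → S → 𝔸ˣ} {e₀ : E} (h : CfgAnalyticAt 𝒱 e₀)
    {G₁ G₂ G₃ G₄ : E → ι → ι → S → 𝔸} (hG₁ : ∀ κ ν y, AnalyticAt ℂ (fun e => G₁ e κ ν y) e₀)
    (hG₂ : ∀ κ ν y, AnalyticAt ℂ (fun e => G₂ e κ ν y) e₀) (hG₃ : ∀ κ ν y, AnalyticAt ℂ (fun e => G₃ e κ ν y) e₀)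
    (hG₄ : ∀ κ ν y, AnalyticAt ℂ (fun e => G₄ e κ ν y) e₀) (μ : ι) (x : S) :
    AnalyticAt ℂ (fun e => divL T (𝒱 e) (G₁ e) (G₂ e) (G₃ e) (G₄ e) μ x) e₀ := by
  simp only [divL]
  refine AnalyticAt.sub ?_ ?_
  · refine Finset.analyticAt_fun_sum _ fun ν _ => ?_
    by_cases hν : ν < μ
    · simp only [hν, if_true]
      exact (analyticAt_R_inv h (hG₄ ν μ _) ν _).sub (hG₂ ν μ x)
    · simp only [hν, if_false]
      exact analyticAt_const
  · refine Finset.analyticAt_fun_sum _ fun ν _ => ?_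
    by_cases hν : μ < ν
    · simp only [hν, if_true]
      exact (analyticAt_R_inv h (hG₁ μ ν _) ν _).sub (hG₃ μ ν x)
    · simp only [hν, if_false]
      exact analyticAt_const

/-- **`Δ′` ALONG AN ANALYTIC FAMILY.**  `e ↦ (Δ′(𝒱(e))A(e))(b)` (`B9Eq310Hermitian.deltaPrimeOp`, the operator of (3.10)) is
analytic at `e₀` for an analytic family of configurations `𝒱` and a letterwise-analytic field `A`.  With `𝒱 = U′U` this is the
analyticity in the exponent field of `Δ′(U′U)` («Δ′(U′U) is a small perturbation itself», p. 404), with `𝒱 ≡ U` that of `Δ′(U)A` in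
`A`. [folklore] [cite: Balaban1985BackgroundPropagators, (3.10) p.392; (3.69) p.404; p.407 after (3.83)] -/
theorem analyticAt_deltaPrimeOp {𝒱 : E → ι → S → 𝔸ˣ} {e₀ : E} (h : CfgAnalyticAt 𝒱 e₀) (η : ℝ)
    {𝒜 : E → ι → S → 𝔸} (h𝒜 : ∀ κ z, AnalyticAt ℂ (fun e => 𝒜 e κ z) e₀) (μ : ι) (x : S) :
    AnalyticAt ℂ (fun e => deltaPrimeOp T (𝒱 e) η (𝒜 e) μ x) e₀ := by
  simp only [deltaPrimeOp]
  exact (analyticAt_divP h (F := fun e => jordanF T (𝒱 e) η (𝒜 e)) (analyticAt_jordanF h η h𝒜) μ x).add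
    (analyticAt_divL h (G₁ := fun e => commG₁ T (𝒱 e) η (𝒜 e)) (G₂ := fun e => commG₂ T (𝒱 e) η (𝒜 e))
      (G₃ := fun e => commG₃ T (𝒱 e) η (𝒜 e)) (G₄ := fun e => commG₄ T (𝒱 e) η (𝒜 e))
      (analyticAt_commG₁ h η h𝒜) (analyticAt_commG₂ h η h𝒜) (analyticAt_commG₃ h η h𝒜) (analyticAt_commG₄ h η h𝒜) μ x)

end DeltaPrime

/-! ## §5 `V₁`, `V₂`, `V₃` analytic in `(A, A′)`; the headline statements; the domain (3.37) -/

section V3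

variable {𝔸 : Type*} [NormedRing 𝔸] [NormedAlgebra ℂ 𝔸] [CompleteSpace 𝔸] {S : Type*} {ι : Type*}
variable {E : Type*} [NormedAddCommGroup E] [NormedSpace ℂ E]
variable (T : ι → Equiv.Perm S) (U : ι → S → 𝔸ˣ) [Fintype ι]

/-- **`V₁(A)A′` IS ANALYTIC IN `(A, A′)`** along any analytic parametrisation `e ↦ (A(e), A′(e))`: by
`B9Eq372Operator.V₁op_eq_lapDD_sub`, `V₁(A)A′ = D*_UD_UA′ − D*_{U′U}D_{U′U}A′`, and both terms are analytic (§3 with the constant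
family `U` and with `U′U`). [folklore] [cite: Balaban1985BackgroundPropagators, (3.71) p.405; p.407 after (3.83)] -/
theorem analyticAt_V₁op (η : ℝ) {𝒜 𝒜' : E → ι → S → 𝔸} {e₀ : E}
    (h𝒜 : ∀ κ z, AnalyticAt ℂ (fun e => 𝒜 e κ z) e₀) (h𝒜' : ∀ κ z, AnalyticAt ℂ (fun e => 𝒜' e κ z) e₀)
    (μ : ι) (x : S) :
    AnalyticAt ℂ (fun e => V₁op T U η (𝒜 e) (𝒜' e) μ x) e₀ := by
  simp only [V₁op_eq_lapDD_sub]
  exact (analyticAt_lapDD (cfgAnalyticAt_const U e₀) h𝒜' μ x).sub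
    (analyticAt_lapDD (cfgAnalyticAt_prodCfg U η h𝒜) h𝒜' μ x)

/-- **`V₂(A)A′` IS ANALYTIC IN `(A, A′)`**: `V₂(A)A′ = D_UD*_UA′ − D_{U′U}D*_{U′U}A′` (`B9Eq372Operator.V₂op_eq_gradDiv_sub`).
[folklore] [cite: Balaban1985BackgroundPropagators, (3.75) p.405; p.407 after (3.83)] -/
theorem analyticAt_V₂op (η : ℝ) {𝒜 𝒜' : E → ι → S → 𝔸} {e₀ : E}
    (h𝒜 : ∀ κ z, AnalyticAt ℂ (fun e => 𝒜 e κ z) e₀) (h𝒜' : ∀ κ z, AnalyticAt ℂ (fun e => 𝒜' e κ z) e₀)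
    (μ : ι) (x : S) :
    AnalyticAt ℂ (fun e => V₂op T U η (𝒜 e) (𝒜' e) μ x) e₀ := by
  simp only [V₂op_eq_gradDiv_sub]
  exact (analyticAt_gradDiv (cfgAnalyticAt_const U e₀) h𝒜' μ x).sub
    (analyticAt_gradDiv (cfgAnalyticAt_prodCfg U η h𝒜) h𝒜' μ x)

variable [LinearOrder ι]

/-- **THE GENERAL STATEMENT — `(V₃(A)A′)(b)` IS ANALYTIC IN `(A, A′)`** along any analytic parametrisation `e ↦ (A(e), A′(e))`
(every letter analytic at `e₀`): `V₃val = η⁻²V₁op − ((Δ′(U′U)A′)(b) − (Δ′(U)A′)(b)) + η⁻²V₂op` (`B9Eq373V3.V₃val`, definitional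
unfolding of `B9Eq386Neumann.vThree`) and each of the four terms is analytic by §§3–5. [folklore]
[cite: Balaban1985BackgroundPropagators, (3.82) p.407; p.407 after (3.83)] -/
theorem analyticAt_V₃val (η : ℝ) {𝒜 𝒜' : E → ι → S → 𝔸} {e₀ : E}
    (h𝒜 : ∀ κ z, AnalyticAt ℂ (fun e => 𝒜 e κ z) e₀) (h𝒜' : ∀ κ z, AnalyticAt ℂ (fun e => 𝒜' e κ z) e₀)
    (μ : ι) (x : S) :
    AnalyticAt ℂ (fun e => V₃val T U η (𝒜 e) (𝒜' e) μ x) e₀ := by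
  simp only [V₃val, vThree]
  exact ((analyticAt_csmul _ (analyticAt_V₁op T U η h𝒜 h𝒜' μ x)).sub
    ((analyticAt_deltaPrimeOp (cfgAnalyticAt_prodCfg U η h𝒜) η h𝒜' μ x).sub
      (analyticAt_deltaPrimeOp (cfgAnalyticAt_const U e₀) η h𝒜' μ x))).add
    (analyticAt_csmul _ (analyticAt_V₂op T U η h𝒜 h𝒜' μ x))

/-- **HEADLINE (ii) — ANY LATTICE, COMPLEX LINES.**  For every background `U`, fields `A`, `B`, `A′`, bond `b = ⟨x, x+e_μ⟩` and
`η`, the map `t ↦ (V₃(A + tB)A′)(b)` is analytic on all of `ℂ` (entire): «depend analytically on A» in the Gâteaux sense, with no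
finiteness assumption on the lattice. [folklore] [cite: Balaban1985BackgroundPropagators, p.407 after (3.83)] -/
theorem analyticOnNhd_V₃val_line (η : ℝ) (A B A' : ι → S → 𝔸) (μ : ι) (x : S) :
    AnalyticOnNhd ℂ (fun t : ℂ => V₃val T U η (A + t • B) A' μ x) Set.univ := fun t₀ _ =>
  analyticAt_V₃val T U η (𝒜 := fun t : ℂ => A + t • B) (𝒜' := fun _ => A')
    (fun κ z => show AnalyticAt ℂ (fun t : ℂ => A κ z + t • B κ z) t₀ from
      analyticAt_const.add (analyticAt_id.smul analyticAt_const))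
    (fun _ _ => analyticAt_const) μ x

/-- COROLLARY: complex differentiability along every complex line (any lattice). [folklore]
[cite: Balaban1985BackgroundPropagators, p.407 after (3.83)] -/
theorem differentiable_V₃val_line (η : ℝ) (A B A' : ι → S → 𝔸) (μ : ι) (x : S) :
    Differentiable ℂ (fun t : ℂ => V₃val T U η (A + t • B) A' μ x) := fun t =>
  (analyticOnNhd_V₃val_line T U η A B A' μ x t (Set.mem_univ t)).differentiableAt

end V3

section Finite

variable {𝔸 : Type*} [NormedRing 𝔸] [NormedAlgebra ℂ 𝔸] {S : Type*} {ι : Type*} [Fintype ι] [Fintype S]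

/-- On a finite lattice the field space `ι → S → 𝔸` is a complex normed space (sup norm (3.39)) and every letter `A ↦ A(b′)` is a
continuous linear functional, hence analytic. [folklore] [cite: Balaban1985BackgroundPropagators, (3.39) p.397] -/
theorem analyticAt_apply₂ (κ : ι) (z : S) (A₀ : ι → S → 𝔸) :
    AnalyticAt ℂ (fun A : ι → S → 𝔸 => A κ z) A₀ :=
  ((ContinuousLinearMap.proj (R := ℂ) (φ := fun _ : S => 𝔸) z).comp
    (ContinuousLinearMap.proj (R := ℂ) (φ := fun _ : ι => S → 𝔸) κ)).analyticAt A₀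

/-- The letters of the pair parametrisation, first component `(A, A′) ↦ A(b′)`. [folklore] -/
theorem analyticAt_fst_apply₂ (κ : ι) (z : S) (p₀ : (ι → S → 𝔸) × (ι → S → 𝔸)) :
    AnalyticAt ℂ (fun p : (ι → S → 𝔸) × (ι → S → 𝔸) => p.1 κ z) p₀ :=
  (((ContinuousLinearMap.proj (R := ℂ) (φ := fun _ : S => 𝔸) z).comp
    (ContinuousLinearMap.proj (R := ℂ) (φ := fun _ : ι => S → 𝔸) κ)).comp
      (ContinuousLinearMap.fst ℂ (ι → S → 𝔸) (ι → S → 𝔸))).analyticAt p₀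

/-- … second component `(A, A′) ↦ A′(b′)`. [folklore] -/
theorem analyticAt_snd_apply₂ (κ : ι) (z : S) (p₀ : (ι → S → 𝔸) × (ι → S → 𝔸)) :
    AnalyticAt ℂ (fun p : (ι → S → 𝔸) × (ι → S → 𝔸) => p.2 κ z) p₀ :=
  (((ContinuousLinearMap.proj (R := ℂ) (φ := fun _ : S => 𝔸) z).comp
    (ContinuousLinearMap.proj (R := ℂ) (φ := fun _ : ι => S → 𝔸) κ)).comp
      (ContinuousLinearMap.snd ℂ (ι → S → 𝔸) (ι → S → 𝔸))).analyticAt p₀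

variable [CompleteSpace 𝔸] (T : ι → Equiv.Perm S) (U : ι → S → 𝔸ˣ)

/-- On a finite lattice the bond variables `A ↦ (U′U)(b′)` are entire functions on the field space. [folklore]
[cite: Balaban1985BackgroundPropagators, p.396 before (3.37)] -/
theorem analyticOnNhd_prodCfg_val (η : ℝ) (κ : ι) (z : S) :
    AnalyticOnNhd ℂ (fun A : ι → S → 𝔸 => (prodCfg U η A κ z : 𝔸)) Set.univ := fun A₀ _ =>
  cfgAnalyticAt_prodCfg U η (𝒜 := fun A => A) (fun κ z => analyticAt_apply₂ κ z A₀) κ z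

/-- … and so are the plaquette variables `A ↦ (U′U)(∂p)`. [folklore] [cite: Balaban1985BackgroundPropagators, (3.1) p.390] -/
theorem analyticOnNhd_plaqU_prodCfg_val (η : ℝ) (κ ν : ι) (y : S) :
    AnalyticOnNhd ℂ (fun A : ι → S → 𝔸 => (plaqU T (prodCfg U η A) κ ν y : 𝔸)) Set.univ := fun A₀ _ =>
  analyticAt_plaqU_val (cfgAnalyticAt_prodCfg U η (𝒜 := fun A => A) (fun κ z => analyticAt_apply₂ κ z A₀)) κ ν y

/-- On a finite lattice `A ↦ (D*_{U′U}D_{U′U}A′)_μ(x)` — the operator whose expansion in `A` is (3.71) — is entire in `A`. [folklore]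
[cite: Balaban1985BackgroundPropagators, (3.71) p.405] -/
theorem analyticOnNhd_lapDD_prodCfg (η : ℝ) (A' : ι → S → 𝔸) (μ : ι) (x : S) :
    AnalyticOnNhd ℂ (fun A : ι → S → 𝔸 => lapDD T (prodCfg U η A) A' μ x) Set.univ := fun A₀ _ =>
  analyticAt_lapDD (cfgAnalyticAt_prodCfg U η (𝒜 := fun A => A) (fun κ z => analyticAt_apply₂ κ z A₀))
    (𝒜 := fun _ => A') (fun _ _ => analyticAt_const) μ x

/-- On a finite lattice `A ↦ (D_{U′U}D*_{U′U}A′)_μ(x)` — the operator expanded in (3.75) — is entire in `A`. [folklore]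
[cite: Balaban1985BackgroundPropagators, (3.75) p.405] -/
theorem analyticOnNhd_gradDiv_prodCfg (η : ℝ) (A' : ι → S → 𝔸) (μ : ι) (x : S) :
    AnalyticOnNhd ℂ (fun A : ι → S → 𝔸 => gradDiv T (prodCfg U η A) A' μ x) Set.univ := fun A₀ _ =>
  analyticAt_gradDiv (cfgAnalyticAt_prodCfg U η (𝒜 := fun A => A) (fun κ z => analyticAt_apply₂ κ z A₀))
    (𝒜 := fun _ => A') (fun _ _ => analyticAt_const) μ x

/-- On a finite lattice `A ↦ (V₁(A)A′)(b)` is entire in `A`. [folklore] [cite: Balaban1985BackgroundPropagators, (3.71), (3.73) p.405] -/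
theorem analyticOnNhd_V₁op (η : ℝ) (A' : ι → S → 𝔸) (μ : ι) (x : S) :
    AnalyticOnNhd ℂ (fun A : ι → S → 𝔸 => V₁op T U η A A' μ x) Set.univ := fun A₀ _ =>
  analyticAt_V₁op T U η (𝒜 := fun A => A) (𝒜' := fun _ => A') (fun κ z => analyticAt_apply₂ κ z A₀)
    (fun _ _ => analyticAt_const) μ x

/-- On a finite lattice `A ↦ (V₂(A)A′)(b)` is entire in `A`. [folklore] [cite: Balaban1985BackgroundPropagators, (3.75) p.405] -/
theorem analyticOnNhd_V₂op (η : ℝ) (A' : ι → S → 𝔸) (μ : ι) (x : S) :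
    AnalyticOnNhd ℂ (fun A : ι → S → 𝔸 => V₂op T U η A A' μ x) Set.univ := fun A₀ _ =>
  analyticAt_V₂op T U η (𝒜 := fun A => A) (𝒜' := fun _ => A') (fun κ z => analyticAt_apply₂ κ z A₀)
    (fun _ _ => analyticAt_const) μ x

variable [LinearOrder ι]

/-- On a finite lattice `A ↦ (Δ′(U′U)A′)(b)` is entire in `A`. [folklore]
[cite: Balaban1985BackgroundPropagators, (3.10) p.392; (3.69) p.404] -/
theorem analyticOnNhd_deltaPrimeOp_prodCfg (η : ℝ) (A' : ι → S → 𝔸) (μ : ι) (x : S) :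
    AnalyticOnNhd ℂ (fun A : ι → S → 𝔸 => deltaPrimeOp T (prodCfg U η A) η A' μ x) Set.univ := fun A₀ _ =>
  analyticAt_deltaPrimeOp (cfgAnalyticAt_prodCfg U η (𝒜 := fun A => A) (fun κ z => analyticAt_apply₂ κ z A₀)) η
    (𝒜 := fun _ => A') (fun _ _ => analyticAt_const) μ x

/-- **HEADLINE (i) — FINITE LATTICE: `A ↦ (V₃(A)A′)(b)` IS ENTIRE.**  For every background `U`, test field `A′`, bond
`b = ⟨x, x+e_μ⟩` and `η`, the map `A ↦ (V₃(A)A′)(b)` is complex-analytic at every point of the field space `ι → S → 𝔸` — in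
particular «in the domain (3.37)» (`analyticOnNhd_V₃val_dom337`). [folklore] [cite: Balaban1985BackgroundPropagators, p.407 after (3.83)] -/
theorem analyticOnNhd_V₃val (η : ℝ) (A' : ι → S → 𝔸) (μ : ι) (x : S) :
    AnalyticOnNhd ℂ (fun A : ι → S → 𝔸 => V₃val T U η A A' μ x) Set.univ := fun A₀ _ =>
  analyticAt_V₃val T U η (𝒜 := fun A => A) (𝒜' := fun _ => A') (fun κ z => analyticAt_apply₂ κ z A₀)
    (fun _ _ => analyticAt_const) μ x

/-- **HEADLINE (i′) — JOINT ANALYTICITY IN `(A, A′)`** on a finite lattice (`V₃(A)A′` is moreover linear in `A′`). [folklore]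
[cite: Balaban1985BackgroundPropagators, p.407 after (3.83)] -/
theorem analyticOnNhd_V₃val_joint (η : ℝ) (μ : ι) (x : S) :
    AnalyticOnNhd ℂ (fun p : (ι → S → 𝔸) × (ι → S → 𝔸) => V₃val T U η p.1 p.2 μ x) Set.univ := fun p₀ _ =>
  analyticAt_V₃val T U η (𝒜 := fun p : (ι → S → 𝔸) × (ι → S → 𝔸) => p.1)
    (𝒜' := fun p : (ι → S → 𝔸) × (ι → S → 𝔸) => p.2)
    (fun κ z => analyticAt_fst_apply₂ κ z p₀) (fun κ z => analyticAt_snd_apply₂ κ z p₀) μ x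

/-- COROLLARY: `A ↦ (V₃(A)A′)(b)` is complex (Fréchet) differentiable everywhere (finite lattice). [folklore]
[cite: Balaban1985BackgroundPropagators, p.407 after (3.83)] -/
theorem differentiable_V₃val (η : ℝ) (A' : ι → S → 𝔸) (μ : ι) (x : S) :
    Differentiable ℂ (fun A : ι → S → 𝔸 => V₃val T U η A A' μ x) := fun A =>
  (analyticOnNhd_V₃val T U η A' μ x A (Set.mem_univ A)).differentiableAt

/-- COROLLARY: continuity in `A` (finite lattice). [folklore] -/
theorem continuous_V₃val (η : ℝ) (A' : ι → S → 𝔸) (μ : ι) (x : S) :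
    Continuous (fun A : ι → S → 𝔸 => V₃val T U η A A' μ x) :=
  (differentiable_V₃val T U η A' μ x).continuous

omit [NormedAlgebra ℂ 𝔸] [CompleteSpace 𝔸] [Fintype ι] [Fintype S] [LinearOrder ι] in
/-- **THE DOMAIN (3.37)** as a set of exponent fields (uniform version: one scale `j`, the conditions on ALL bonds — the
restriction to `Ω_j` is a binder this lineage does not model): `|A| < α₁(L^jη)⁻¹` letterwise and `|∇^η_U A| < α₁(L^jη)⁻²`, i.e.
`‖(D¹_{U,κ}A_τ)(z)‖ < η·α₁(L^jη)⁻²` (`D¹ = η∇^η`, `B9Eq369Product.norm_eta_inv_smul_le_iff`). [folklore]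
[cite: Balaban1985BackgroundPropagators, (3.37) p.396] -/
def dom337 (T : ι → Equiv.Perm S) (U : ι → S → 𝔸ˣ) (η α₁ L : ℝ) (j : ℕ) : Set (ι → S → 𝔸) :=
  {A | (∀ κ z, ‖A κ z‖ < α₁ * (L ^ j * η)⁻¹) ∧ ∀ κ τ z, ‖covD T U κ (A τ) z‖ < η * (α₁ * ((L ^ j * η)⁻¹) ^ 2)}

/-- **THE PRINTED SENTENCE, FOR `V₃`**: «The operators V₃(A), P₁(A), P₂(A) depend analytically on A in the domain (3.37).» —
`A ↦ (V₃(A)A′)(b)` is analytic on the domain (3.37) (finite lattice; restriction of the entire statement `analyticOnNhd_V₃val`; the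
domain is open, `isOpen_dom337`, and contains `0`, `zero_mem_dom337`).  `P₁`, `P₂` are not treated in this lineage. [folklore]
[cite: Balaban1985BackgroundPropagators, p.407 after (3.83); (3.37) p.396] -/
theorem analyticOnNhd_V₃val_dom337 (η α₁ L : ℝ) (j : ℕ) (A' : ι → S → 𝔸) (μ : ι) (x : S) :
    AnalyticOnNhd ℂ (fun A : ι → S → 𝔸 => V₃val T U η A A' μ x) (dom337 T U η α₁ L j) :=
  (analyticOnNhd_V₃val T U η A' μ x).mono (Set.subset_univ _)

omit [NormedAlgebra ℂ 𝔸] [CompleteSpace 𝔸] [LinearOrder ι] in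
/-- The domain (3.37) is OPEN in the field space of a finite lattice (finitely many strict inequalities between continuous
functions of `A`). [folklore] [cite: Balaban1985BackgroundPropagators, (3.37) p.396] -/
theorem isOpen_dom337 (η α₁ L : ℝ) (j : ℕ) : IsOpen (dom337 T U η α₁ L j : Set (ι → S → 𝔸)) := by
  have h1 : ∀ κ z, Continuous fun A : ι → S → 𝔸 => A κ z := fun κ z =>
    (continuous_apply z).comp (continuous_apply κ)
  have h2 : ∀ κ τ z, Continuous fun A : ι → S → 𝔸 => covD T U κ (A τ) z := fun κ τ z => by
    simp only [covD, R]
    exact ((continuous_const.mul (h1 τ _)).mul continuous_const).sub (h1 τ z)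
  simp only [dom337, Set.setOf_and, Set.setOf_forall]
  refine IsOpen.inter ?_ ?_
  · exact isOpen_iInter_of_finite fun κ => isOpen_iInter_of_finite fun z =>
      isOpen_lt (continuous_norm.comp (h1 κ z)) continuous_const
  · exact isOpen_iInter_of_finite fun κ => isOpen_iInter_of_finite fun τ => isOpen_iInter_of_finite fun z =>
      isOpen_lt (continuous_norm.comp (h2 κ τ z)) continuous_const

omit [NormedAlgebra ℂ 𝔸] [CompleteSpace 𝔸] [Fintype ι] [Fintype S] [LinearOrder ι] in
/-- `A = 0` (i.e. `U′ = 1`) lies in the domain (3.37) for positive `α₁`, `η`, `L`. [folklore]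
[cite: Balaban1985BackgroundPropagators, (3.37) p.396] -/
theorem zero_mem_dom337 {η α₁ L : ℝ} (hη : 0 < η) (hα : 0 < α₁) (hL : 0 < L) (j : ℕ) :
    (0 : ι → S → 𝔸) ∈ dom337 T U η α₁ L j := by
  refine ⟨fun κ z => ?_, fun κ τ z => ?_⟩
  · simp only [Pi.zero_apply, norm_zero]; positivity
  · have : covD T U κ ((0 : ι → S → 𝔸) τ) z = 0 := by simp [covD, R]
    rw [this, norm_zero]; positivity

end Finite

/-! ## §6 Sanity checks -/

section Examples

variable {𝔸 : Type*} [NormedRing 𝔸] [NormedAlgebra ℂ 𝔸] [CompleteSpace 𝔸] {S : Type*} {ι : Type*}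
variable (T : ι → Equiv.Perm S) (U : ι → S → 𝔸ˣ) [Fintype ι] [LinearOrder ι]

/-- The one-letter case of §2: `a ↦ e^{iηa}·u` is analytic on `𝔸` (the identity parametrisation of one letter). -/
example (η : ℝ) (u : 𝔸ˣ) (a₀ : 𝔸) : AnalyticAt ℂ (fun a : 𝔸 => exp (((I * η : ℂ)) • a) * (u : 𝔸)) a₀ :=
  (analyticAt_exp_comp (analyticAt_csmul _ analyticAt_id)).mul analyticAt_const

/-- Through the origin in the direction `B`: `t ↦ (V₃(tB)A′)(b)` is differentiable at `t = 0` (any lattice). -/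
example (η : ℝ) (B A' : ι → S → 𝔸) (μ : ι) (x : S) :
    DifferentiableAt ℂ (fun t : ℂ => V₃val T U η ((0 : ι → S → 𝔸) + t • B) A' μ x) 0 :=
  differentiable_V₃val_line T U η 0 B A' μ x 0

/-- Finite lattice: analyticity at the origin of the field space, a point of the domain (3.37). -/
example [Fintype S] {η α₁ L : ℝ} (hη : 0 < η) (hα : 0 < α₁) (hL : 0 < L) (j : ℕ) (A' : ι → S → 𝔸) (μ : ι) (x : S) :
    (0 : ι → S → 𝔸) ∈ dom337 T U η α₁ L j ∧ AnalyticAt ℂ (fun A : ι → S → 𝔸 => V₃val T U η A A' μ x) 0 :=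
  ⟨zero_mem_dom337 T U hη hα hL j, analyticOnNhd_V₃val T U η A' μ x 0 (Set.mem_univ _)⟩

/-- The constant family needs no completeness: with `𝒱 ≡ U` and `A` constant every map of §§3–4 is constant. -/
example (η : ℝ) (A : ι → S → 𝔸) (μ : ι) (x : S) (e₀ : ℂ) :
    AnalyticAt ℂ (fun _ : ℂ => deltaPrimeOp T U η A μ x) e₀ :=
  analyticAt_deltaPrimeOp (cfgAnalyticAt_const U e₀) η (𝒜 := fun _ => A) (fun _ _ => analyticAt_const) μ x

end Examples

end Literature.MathematicalPhysics.QuantumFieldTheory.Balaban1983to89.B9Eq373V3Analytic
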